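import Mathlib
import Summits.Ventures.PercRepro.PuncturedLYMUnif66Table
import Summits.Ventures.PercRepro.PuncturedLYMUnif66Cols1

/-!
# PercRepro — (SP) FOR ANY NUMBER OF PAIRWISE DISJOINT `6`-SETS AT LEVEL `6`: THE COLUMN IDENTITIES, ASSEMBLED
(p10, gen 41)

`col_check`: the column identity of every free column class with `Σ v d_v ≤ 7`, by nested `interval_cases` over the class counts (only the feasible classes are enumerated).  Nothing here asserts (SP).
-/

namespace PercRepro.PuncturedLYM.Split.TypeLift.Unif66

/-- The column identity of every free column class, in one statement. -/
theorem col_check (n k : ℚ) (hQ : Qp n k ≠ 0) (hP : Pp n k ≠ 0) (d1 d2 d3 d4 d5 : ℕ)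
    (h : d1 + 2 * d2 + 3 * d3 + 4 * d4 + 5 * d5 ≤ 7) :
    1 * (d1 : ℚ) * raw n k (d1 - 1) d2 d3 d4 d5 0 + 2 * (d2 : ℚ) * raw n k (d1 + 1) (d2 - 1) d3 d4 d5 1 + 3 * (d3 : ℚ) * raw n k d1 (d2 + 1) (d3 - 1) d4 d5 2 + 4 * (d4 : ℚ) * raw n k d1 d2 (d3 + 1) (d4 - 1) d5 3 + 5 * (d5 : ℚ) * raw n k d1 d2 d3 (d4 + 1) (d5 - 1) 4 +
      ((7 : ℚ) - d1 - 2 * d2 - 3 * d3 - 4 * d4 - 5 * d5) * raw n k d1 d2 d3 d4 d5 6 = 1 := by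
  have hb5 : d5 ≤ 1 := by omega
  interval_cases d5
  · have hb4 : d4 ≤ 1 := by omega
    interval_cases d4
    · have hb3 : d3 ≤ 2 := by omega
      interval_cases d3
      · have hb2 : d2 ≤ 3 := by omega
        interval_cases d2
        · have hb1 : d1 ≤ 7 := by omega
          interval_cases d1
          · push_cast
            linear_combination col_00000 n k hQ hP
          · push_cast
            linear_combination col_10000 n k hQ hP
          · push_cast
            linear_combination col_20000 n k hQ hP
          · push_cast
            linear_combination col_30000 n k hQ hP
          · push_cast
            linear_combination col_40000 n k hQ hP
          · push_cast
            linear_combination col_50000 n k hQ hP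
          · push_cast
            linear_combination col_60000 n k hQ hP
          · push_cast
            linear_combination col_70000 n k hQ hP
        · have hb1 : d1 ≤ 5 := by omega
          interval_cases d1
          · push_cast
            linear_combination col_01000 n k hQ hP
          · push_cast
            linear_combination col_11000 n k hQ hP
          · push_cast
            linear_combination col_21000 n k hQ hP
          · push_cast
            linear_combination col_31000 n k hQ hP
          · push_cast
            linear_combination col_41000 n k hQ hP
          · push_cast
            linear_combination col_51000 n k hQ hP
        · have hb1 : d1 ≤ 3 := by omega
          interval_cases d1
          · push_cast
            linear_combination col_02000 n k hQ hP
          · push_cast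
            linear_combination col_12000 n k hQ hP
          · push_cast
            linear_combination col_22000 n k hQ hP
          · push_cast
            linear_combination col_32000 n k hQ hP
        · have hb1 : d1 ≤ 1 := by omega
          interval_cases d1
          · push_cast
            linear_combination col_03000 n k hQ hP
          · push_cast
            linear_combination col_13000 n k hQ hP
      · have hb2 : d2 ≤ 2 := by omega
        interval_cases d2
        · have hb1 : d1 ≤ 4 := by omega
          interval_cases d1
          · push_cast
            linear_combination col_00100 n k hQ hP
          · push_cast
            linear_combination col_10100 n k hQ hP
          · push_cast
            linear_combination col_20100 n k hQ hP
          · push_cast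
            linear_combination col_30100 n k hQ hP
          · push_cast
            linear_combination col_40100 n k hQ hP
        · have hb1 : d1 ≤ 2 := by omega
          interval_cases d1
          · push_cast
            linear_combination col_01100 n k hQ hP
          · push_cast
            linear_combination col_11100 n k hQ hP
          · push_cast
            linear_combination col_21100 n k hQ hP
        · have hb1 : d1 ≤ 0 := by omega
          interval_cases d1
          · push_cast
            linear_combination col_02100 n k hQ hP
      · have hb2 : d2 ≤ 0 := by omega
        interval_cases d2
        · have hb1 : d1 ≤ 1 := by omega
          interval_cases d1
          · push_cast
            linear_combination col_00200 n k hQ hP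
          · push_cast
            linear_combination col_10200 n k hQ hP
    · have hb3 : d3 ≤ 1 := by omega
      interval_cases d3
      · have hb2 : d2 ≤ 1 := by omega
        interval_cases d2
        · have hb1 : d1 ≤ 3 := by omega
          interval_cases d1
          · push_cast
            linear_combination col_00010 n k hQ hP
          · push_cast
            linear_combination col_10010 n k hQ hP
          · push_cast
            linear_combination col_20010 n k hQ hP
          · push_cast
            linear_combination col_30010 n k hQ hP
        · have hb1 : d1 ≤ 1 := by omega
          interval_cases d1
          · push_cast
            linear_combination col_01010 n k hQ hP
          · push_cast
            linear_combination col_11010 n k hQ hP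
      · have hb2 : d2 ≤ 0 := by omega
        interval_cases d2
        · have hb1 : d1 ≤ 0 := by omega
          interval_cases d1
          · push_cast
            linear_combination col_00110 n k hQ hP
  · have hb4 : d4 ≤ 0 := by omega
    interval_cases d4
    · have hb3 : d3 ≤ 0 := by omega
      interval_cases d3
      · have hb2 : d2 ≤ 1 := by omega
        interval_cases d2
        · have hb1 : d1 ≤ 2 := by omega
          interval_cases d1
          · push_cast
            linear_combination col_00001 n k hQ hP
          · push_cast
            linear_combination col_10001 n k hQ hP
          · push_cast
            linear_combination col_20001 n k hQ hP
        · have hb1 : d1 ≤ 0 := by omega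
          interval_cases d1
          · push_cast
            linear_combination col_01001 n k hQ hP

end PercRepro.PuncturedLYM.Split.TypeLift.Unif66
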